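import Literature.Geometry.Kaehler.ComplexTorusMaps
import Literature.Geometry.Kaehler.ComplexTorusAverage
import Literature.Analysis.Complex.SeveralVariables
import Mathlib.Geometry.Manifold.Complex
import Mathlib.Analysis.Calculus.MeanValue
import HarnessLib

/-!
# Holomorphic maps of complex tori are translates of homomorphisms (Lange–Birkenhake Prop. 1.1.6)

Companion of `Literature/Geometry/Kaehler/ComplexTorusMaps.lean`, which proves that a map of complex
tori `X = E/Φ(ℤ^ι) → X' = E'/Φ'(ℤ^ι')` with a holomorphic lift is holomorphic and that the
homomorphism `ComplexTorus.mapMatrix A` of an integer matrix `A` whose analytic representation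
`Φ' ∘ A_ℝ ∘ Φ⁻¹` is `ℂ`-linear is holomorphic (`ComplexTorus.contMDiff_mapMatrix`). This file proves
the CONVERSE, Lange–Birkenhake (1992), §1.1.2, Proposition 1.1.6:

* `ComplexTorus.mfderiv_eq_mfderiv` (`exists_mfderiv_eq_const`): the differential
  `x ↦ df(x) : X → (E →L[ℂ] E')` of a holomorphic map `f : X → X'` (in the canonical
  trivialisations of the tangent bundles) is CONSTANT, `df ≡ L`;
* `ComplexTorus.apply_cover_eq_of_mfderiv_eq`, `ComplexTorus.exists_affine_lift`: the LIFT of `f`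
  to the universal covers is affine, `f (π z) = π' (L z) + f 0 = π' (L z + c)`, and `L` carries the
  lattice `Φ(ℤ^ι)` into `Φ'(ℤ^ι')` (`ComplexTorus.cover_eq_zero_iff`: the kernel of `π` is the
  lattice);
* `ComplexTorus.exists_matrix_of_lattice_le`: a `ℂ`-linear `L` with `L(Φ ℤ^ι) ⊆ Φ' ℤ^ι'` is the
  analytic representation `Φ' ∘ A_ℝ ∘ Φ⁻¹` of an integer matrix `A`;
* `ComplexTorus.exists_eq_mapMatrix_add`: **every holomorphic map of complex tori is the translate
  by `f 0` of the homomorphism `mapMatrix A`** of an integer matrix `A ∈ M(ι' × ι, ℤ)` (the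
  rational representation) whose analytic representation `Φ' ∘ A_ℝ ∘ Φ⁻¹ = L = df` is `ℂ`-linear —
  exactly the hypothesis of `contMDiff_mapMatrix`, so the two files together say: the holomorphic
  maps `X → X'` are precisely the translates of the `mapMatrix A` with `ℂ`-linear analytic
  representation (Prop. 1.1.6); `exists_eq_mapMatrix_of_map_zero`, `map_add_of_mdifferentiable`,
  `map_add_add_map_zero`: a holomorphic map with `f 0 = 0` is a homomorphism;
* `ComplexTorus.mapMatrix_injective`, `matrix_unique`: the rational representation is faithful
  (`mapMatrix A = mapMatrix B → A = B`), and `ComplexTorus.realRep_eq_mfderiv`: the analytic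
  representation of `mapMatrix A + c` is its (real) differential;
* tools: `ComplexTorus.hasMFDerivAt_extChartAt_of_mem_source` (the charts have derivative `id`
  over `𝕜 ∈ {ℝ, ℂ}`), `ComplexTorus.hasFDerivAt_localRep` (the local representative
  `φ' ∘ f ∘ π` of `f` over a chart `φ'` of `X'` has derivative `df`).

## Proof

Not the printed one (which lifts `f` to the universal covers by simple connectivity and applies
Liouville to the partial derivatives of the lift); we avoid covering-space theory and the Lie-group
structure: (1) near every `z₀ ∈ E` the map `f ∘ π` has the local representative
`g = φ' ∘ f ∘ π` (`φ'` the preferred chart of `X'` at `f (π z₀)`), holomorphic on the open set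
`{z | f (π z) ∈ source φ'}` with `dg(z) = df(π z)` (`dπ = id`, `dφ' = id`:
`hasFDerivAt_localRep`); (2) by the Cauchy formula in several variables
(`Literature.Analysis.Complex.SCV.differentiableOn_fderiv_apply`) each `z ↦ dg(z) v` is
holomorphic, so `x ↦ df(x) v : X → E'` is holomorphic on the compact connected complex manifold
`X`, hence constant (Mathlib's `MDifferentiable.apply_eq_of_compactSpace`, the maximum principle):
`df ≡ L`; (3) `z ↦ f (π z) - π' (L z)` is then locally constant on `E` (`g - L` has zero derivative
on balls, `π'` is additive), hence constant `= f 0`; (4) evaluating at lattice vectors,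
`π' (L (Φ n)) = 0`, so `L (Φ n) ∈ Φ'(ℤ^ι')` and the integer coordinates form the matrix `A` with
`Φ' ∘ A_ℝ = L ∘ Φ`; `mapMatrix_proj` gives `f = mapMatrix A + f 0`.

Everything here is a theorem; no definition and no named fact is introduced.

## Not here

The transport to complex abelian varieties (`Motives.AbelianVariety ℂ`: uniformisation
`A(ℂ) ≅ T₀A/H₁`, algebraisation of holomorphic homomorphisms), i.e. Riemann's theorem
`HodgeTheory.DeligneMilne1982_Thm_6_20_full`; isogenies, kernels, images (Lange–Birkenhake §1.1.2
after Prop. 1.1.6).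

## References

* H. Lange, Ch. Birkenhake, *Complex Abelian Varieties*, Grundlehren 302 (1992), §1.1.2,
  Proposition 1.1.6 and the injectivity of the analytic and rational representations `ρₐ`, `ρᵣ`.
  [LangeBirkenhake1992]
-/

noncomputable section

open scoped Manifold ContDiff Topology
open Set Filter

namespace Literature.Geometry.Kaehler

namespace ComplexTorus

variable {ι ι' : Type*}
  {E E' : Type*} [NormedAddCommGroup E] [NormedSpace ℂ E] [NormedAddCommGroup E'] [NormedSpace ℂ E']
  {Φ : (ι → ℝ) ≃L[ℝ] E} {Φ' : (ι' → ℝ) ≃L[ℝ] E'}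

/-! ### The covering map as a group homomorphism; its kernel is the lattice -/

variable (Φ) in
/-- `π (z - w) = π z - π w` (the covering map `π : E → E/Φ(ℤ^ι)` is a group homomorphism,
Lange–Birkenhake (1992), §1.1.1: `X = V/Λ` as a quotient group). [cite: LangeBirkenhake1992, §1.1.1] -/
theorem cover_sub (z w : E) : cover Φ (z - w) = cover Φ z - cover Φ w := by
  rw [cover_apply, cover_apply, cover_apply, map_sub]
  rfl

variable (Φ) in
/-- `π (Φ n) = 0` for an integer vector `n`. [cite: LangeBirkenhake1992, Lemma 1.1.3] -/
@[simp] theorem cover_latticeVec (n : ι → ℤ) : cover Φ (latticeVec Φ n) = 0 := by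
  simpa using cover_add_latticeVec Φ 0 n

variable (Φ) in
/-- **The kernel of the covering map is the lattice**: `π z = 0 ↔ z ∈ Φ(ℤ^ι)`.
[cite: LangeBirkenhake1992, Lemma 1.1.3] -/
theorem cover_eq_zero_iff (z : E) : cover Φ z = 0 ↔ ∃ n : ι → ℤ, z = latticeVec Φ n := by
  constructor
  · intro h
    have hi : ∀ i, ∃ n : ℤ, (Φ.symm z i : ℝ) = n := by
      intro i
      have hi' := congrFun h i
      simp only [cover_apply, proj_apply] at hi'
      obtain ⟨n, hn⟩ := (AddCircle.coe_eq_zero_iff (1 : ℝ)).mp hi'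
      exact ⟨n, by rw [← hn, zsmul_eq_mul, mul_one]⟩
    choose n hn using hi
    refine ⟨n, ?_⟩
    have hz : Φ.symm z = fun i ↦ (n i : ℝ) := funext hn
    rw [latticeVec, ← hz, ContinuousLinearEquiv.apply_symm_apply]
  · rintro ⟨n, rfl⟩
    exact cover_latticeVec Φ n

/-! ### Charts are local sections of the covering map with derivative the identity -/

variable [Fintype ι] [Fintype ι']

variable (Φ) in
/-- `π (φₓ y) = y` for `y` in the domain of the preferred chart `φₓ` at `x`: the charts are local
sections of the covering map (Lange–Birkenhake (1992), Lemma 1.1.3 (a): `π` is a local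
homeomorphism whose local inverses are the charts). [cite: LangeBirkenhake1992, Lemma 1.1.3] -/
theorem cover_extChartAt {𝕜 : Type*} [NontriviallyNormedField 𝕜] [NormedSpace 𝕜 E]
    {x y : ComplexTorus Φ} (hy : y ∈ (chartAt E x).source) :
    cover Φ (extChartAt 𝓘(𝕜, E) x y) = y := by
  rw [← extChartAt_symm_eq_cover Φ (𝕜 := 𝕜) x]
  exact (extChartAt 𝓘(𝕜, E) x).left_inv (by rwa [extChartAt_source])

variable (Φ) in
/-- **The charts of a complex torus have derivative the identity** on their whole domain, over
`𝕜 ∈ {ℝ, ℂ}` (written through the covering map, a chart is locally a translation;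
the real case in `mfderiv` form is `ComplexTorus.mfderiv_extChartAt_eq_id`).
[cite: LangeBirkenhake1992, Lemma 1.1.3] -/
theorem hasMFDerivAt_extChartAt_of_mem_source {𝕜 : Type*} [NontriviallyNormedField 𝕜]
    [NormedSpace 𝕜 E] {x y : ComplexTorus Φ} (hy : y ∈ (chartAt E x).source) :
    HasMFDerivAt 𝓘(𝕜, E) 𝓘(𝕜, E) (extChartAt 𝓘(𝕜, E) x) y (ContinuousLinearMap.id 𝕜 E) := by
  refine ⟨continuousAt_extChartAt' (by rwa [extChartAt_source]), ?_⟩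
  have hfun : writtenInExtChartAt 𝓘(𝕜, E) 𝓘(𝕜, E) y (extChartAt 𝓘(𝕜, E) x) =
      fun w ↦ chart Φ (corner Φ x) (cover Φ w) := by
    funext w
    simp [writtenInExtChartAt, chartAt_eq, cover_apply]
  rw [hfun]
  have hmem : cover Φ (extChartAt 𝓘(𝕜, E) y y) ∈ (chart Φ (corner Φ x)).source := by
    rw [cover_extChartAt_self, ← chartAt_eq]
    exact hy
  have hev := eventuallyEq_chart_cover Φ (a := corner Φ x) (z₀ := extChartAt 𝓘(𝕜, E) y y) hmem
  exact (((hasFDerivAt_id _).sub_const _).congr_of_eventuallyEq hev).hasFDerivWithinAt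

/-! ### The local representative of a map of tori over a chart of the target -/

omit [Fintype ι] in
/-- **The local representative `g = φ' ∘ f ∘ π` lifts `f ∘ π`**: for `z` with `f (π z)` in the
domain of the chart `φ'` of `X'` (centred anywhere), `π' (g z) = f (π z)` (private helper:
`cover_extChartAt` read for the target torus). [folklore] -/
private theorem cover_localRep {f : ComplexTorus Φ → ComplexTorus Φ'} {x' : ComplexTorus Φ'} {z : E}
    (hz : f (cover Φ z) ∈ (chartAt E' x').source) :
    cover Φ' (extChartAt 𝓘(ℂ, E') x' (f (cover Φ z))) = f (cover Φ z) :=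
  cover_extChartAt Φ' hz

/-- **The derivative of the local representative is the differential of `f`**: if `f` is
complex differentiable at `π z` and `f (π z)` lies in the domain of the chart `φ'` of `X'`, then
`g = φ' ∘ f ∘ π : E → E'` has derivative `L = df(π z)` at `z` (`dπ = id`, `dφ' = id`; the tangent
spaces are identified with `E`, `E'` by the canonical trivialisations, which is what the
hypothesis `hL` spells out). Lange–Birkenhake (1992), §1.1.2 (the analytic representation as the
differential of the lift). [cite: LangeBirkenhake1992, §1.1.2] -/
theorem hasFDerivAt_localRep {f : ComplexTorus Φ → ComplexTorus Φ'} {x' : ComplexTorus Φ'} {z : E}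
    (hf : MDifferentiableAt 𝓘(ℂ, E) 𝓘(ℂ, E') f (cover Φ z))
    (hz : f (cover Φ z) ∈ (chartAt E' x').source) {L : E →L[ℂ] E'}
    (hL : mfderiv 𝓘(ℂ, E) 𝓘(ℂ, E') f (cover Φ z) = L) :
    HasFDerivAt (fun w ↦ extChartAt 𝓘(ℂ, E') x' (f (cover Φ w))) L z := by
  have h1 : HasMFDerivAt 𝓘(ℂ, E) 𝓘(ℂ, E) (cover Φ) z (ContinuousLinearMap.id ℂ E) :=
    hasMFDerivAt_cover Φ z
  have h2 : HasMFDerivAt 𝓘(ℂ, E) 𝓘(ℂ, E') f (cover Φ z) (mfderiv 𝓘(ℂ, E) 𝓘(ℂ, E') f (cover Φ z)) :=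
    hf.hasMFDerivAt
  have h3 : HasMFDerivAt 𝓘(ℂ, E') 𝓘(ℂ, E') (extChartAt 𝓘(ℂ, E') x') (f (cover Φ z))
      (ContinuousLinearMap.id ℂ E') :=
    hasMFDerivAt_extChartAt_of_mem_source Φ' hz
  have h := hasMFDerivAt_iff_hasFDerivAt.1 ((h3.comp (cover Φ z) h2).comp z h1)
  refine h.congr_fderiv ?_
  rw [← hL]
  ext v
  rfl

/-! ### The differential of a holomorphic map of tori is constant -/

/-- **The differential of a holomorphic map of complex tori is constant.** For a holomorphic
`f : X → X'` the map `x ↦ df(x) : X → (E →L[ℂ] E')` (canonical trivialisations) is constant: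
each `x ↦ df(x) v` is a holomorphic function on the compact connected complex manifold `X` with
values in the vector space `E'` (locally it is a partial derivative of the holomorphic local
representative, holomorphic by the Cauchy formula), hence constant by the maximum principle.
Lange–Birkenhake (1992), §1.1.2, proof of Prop. 1.1.6 (the partial derivatives of the lift are
bounded holomorphic functions, hence constant). [cite: LangeBirkenhake1992, Proposition 1.1.6] -/
theorem mfderiv_eq_mfderiv {f : ComplexTorus Φ → ComplexTorus Φ'}
    (hf : MDifferentiable 𝓘(ℂ, E) 𝓘(ℂ, E') f) (x y : ComplexTorus Φ) :
    mfderiv 𝓘(ℂ, E) 𝓘(ℂ, E') f x = mfderiv 𝓘(ℂ, E) 𝓘(ℂ, E') f y := by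
  haveI : FiniteDimensional ℝ E' := LinearEquiv.finiteDimensional Φ'.toLinearEquiv
  haveI : CompleteSpace E' := FiniteDimensional.complete ℝ E'
  -- it suffices to treat each `x ↦ df(x) v : X → E'`
  suffices hv : ∀ v : E,
      MDifferentiable 𝓘(ℂ, E) 𝓘(ℂ, E') fun x ↦ (mfderiv 𝓘(ℂ, E) 𝓘(ℂ, E') f x : E →L[ℂ] E') v by
    ext v
    exact (hv v).apply_eq_of_compactSpace (I := 𝓘(ℂ, E)) x y
  intro v x₀
  -- the local representative over the chart of `X'` at `f x₀`
  set x₀' : ComplexTorus Φ' := f x₀ with hx₀'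
  set U : Set E := {z | f (cover Φ z) ∈ (chartAt E' x₀').source} with hU_def
  have hU : IsOpen U :=
    (chartAt E' x₀').open_source.preimage (hf.continuous.comp (continuous_cover Φ))
  set g : E → E' := fun w ↦ extChartAt 𝓘(ℂ, E') x₀' (f (cover Φ w)) with hg_def
  -- (no type ascription: the statement of `hasFDerivAt_localRep` types the derivative as a map
  -- `E →L[ℂ] E'`, not between tangent spaces)
  have hgd := fun z (hz : z ∈ U) ↦ hasFDerivAt_localRep (x' := x₀') (hf (cover Φ z)) hz rfl
  have hg : DifferentiableOn ℂ g U := fun z hz ↦ (hgd z hz).differentiableAt.differentiableWithinAt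
  -- the partial derivative `z ↦ dg(z) v` is holomorphic on `U` (Cauchy formula)
  have hDg : DifferentiableOn ℂ (fun z ↦ fderiv ℂ g z v) U :=
    Literature.Analysis.Complex.SCV.differentiableOn_fderiv_apply hg hU v
  -- the centre of the chart at `x₀` lies in `U`
  set z₀ : E := extChartAt 𝓘(ℂ, E) x₀ x₀ with hz₀
  have hz₀U : z₀ ∈ U := by
    change f (cover Φ (extChartAt 𝓘(ℂ, E) x₀ x₀)) ∈ (chartAt E' x₀').source
    rw [cover_extChartAt_self]
    exact mem_chart_source E' x₀'
  -- `(df ∘ π) v = dg v` near `z₀`, so `(df ∘ π) v` is differentiable at `z₀`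
  have hcomp : DifferentiableAt ℂ
      (fun z ↦ (mfderiv 𝓘(ℂ, E) 𝓘(ℂ, E') f (cover Φ z) : E →L[ℂ] E') v) z₀ := by
    refine (hDg.differentiableAt (hU.mem_nhds hz₀U)).congr_of_eventuallyEq ?_
    filter_upwards [hU.mem_nhds hz₀U] with z hz
    exact (congrArg (fun T : E →L[ℂ] E' ↦ T v) (hgd z hz).fderiv).symm
  have hcomp' : MDifferentiableAt 𝓘(ℂ, E) 𝓘(ℂ, E')
      (fun z ↦ (mfderiv 𝓘(ℂ, E) 𝓘(ℂ, E') f (cover Φ z) : E →L[ℂ] E') v) z₀ :=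
    mdifferentiableAt_iff_differentiableAt.2 hcomp
  have hchart : MDifferentiableAt 𝓘(ℂ, E) 𝓘(ℂ, E) (extChartAt 𝓘(ℂ, E) x₀) x₀ :=
    mdifferentiableAt_extChartAt (mem_chart_source E x₀)
  have hc := hcomp'.comp x₀ hchart
  refine hc.congr_of_eventuallyEq ?_
  filter_upwards [(chartAt E x₀).open_source.mem_nhds (mem_chart_source E x₀)] with y hy
  simp only [Function.comp_apply]
  rw [cover_extChartAt Φ (𝕜 := ℂ) hy]

/-- `df ≡ L` for one continuous `ℂ`-linear `L : E → E'` (existential form of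
`mfderiv_eq_mfderiv`). [cite: LangeBirkenhake1992, Proposition 1.1.6] -/
theorem exists_mfderiv_eq_const {f : ComplexTorus Φ → ComplexTorus Φ'}
    (hf : MDifferentiable 𝓘(ℂ, E) 𝓘(ℂ, E') f) :
    ∃ L : E →L[ℂ] E', ∀ x, mfderiv 𝓘(ℂ, E) 𝓘(ℂ, E') f x = L :=
  ⟨mfderiv 𝓘(ℂ, E) 𝓘(ℂ, E') f 0, fun x ↦ mfderiv_eq_mfderiv hf x 0⟩

/-! ### The lift of a holomorphic map is affine -/

/-- **The lift of a holomorphic map of complex tori is affine**: if `f : X → X'` is holomorphic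
with (constant) differential `L`, then `f (π z) = π' (L z) + f 0` for every `z ∈ E` — the map
`z ↦ f (π z) - π' (L z)` is locally constant (its local representatives `g - L` have zero
derivative on balls) on the connected space `E`. Lange–Birkenhake (1992), §1.1.2, Prop. 1.1.6
(`f = t_{f(0)} ∘ h` with `h` induced by a `ℂ`-linear map of the universal covers).
[cite: LangeBirkenhake1992, Proposition 1.1.6] -/
theorem apply_cover_eq_of_mfderiv_eq {f : ComplexTorus Φ → ComplexTorus Φ'}
    (hf : MDifferentiable 𝓘(ℂ, E) 𝓘(ℂ, E') f) {L : E →L[ℂ] E'}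
    (hL : ∀ x, mfderiv 𝓘(ℂ, E) 𝓘(ℂ, E') f x = L) (z : E) :
    f (cover Φ z) = cover Φ' (L z) + f 0 := by
  set F : E → ComplexTorus Φ' := fun z ↦ f (cover Φ z) - cover Φ' (L z) with hF
  have hFlc : IsLocallyConstant F := by
    refine (IsLocallyConstant.iff_eventually_eq F).2 fun z₀ ↦ ?_
    -- the local representative over the chart of `X'` at `f (π z₀)`
    set x₀' : ComplexTorus Φ' := f (cover Φ z₀) with hx₀'
    set U : Set E := {z | f (cover Φ z) ∈ (chartAt E' x₀').source} with hU_def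
    have hU : IsOpen U :=
      (chartAt E' x₀').open_source.preimage (hf.continuous.comp (continuous_cover Φ))
    have hz₀U : z₀ ∈ U := mem_chart_source E' x₀'
    obtain ⟨r, hr, hrU⟩ := Metric.isOpen_iff.1 hU z₀ hz₀U
    set g : E → E' := fun w ↦ extChartAt 𝓘(ℂ, E') x₀' (f (cover Φ w)) with hg_def
    -- `g - L` has zero derivative on the ball, hence is constant there
    have hd : ∀ z ∈ Metric.ball z₀ r, HasFDerivAt (fun w ↦ g w - L w) (0 : E →L[ℂ] E') z := by
      intro z hz
      have h := (hasFDerivAt_localRep (x' := x₀') (hf _) (hrU hz) (hL _)).sub L.hasFDerivAt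
      rwa [sub_self] at h
    have hconst : ∀ z ∈ Metric.ball z₀ r, g z - L z = g z₀ - L z₀ := fun z hz ↦
      Metric.isOpen_ball.is_const_of_fderiv_eq_zero (convex_ball z₀ r).isPreconnected
        (fun w hw ↦ (hd w hw).differentiableAt.differentiableWithinAt)
        (fun w hw ↦ (hd w hw).fderiv) hz (Metric.mem_ball_self hr)
    filter_upwards [Metric.isOpen_ball.mem_nhds (Metric.mem_ball_self hr)] with z hz
    have hgz : cover Φ' (g z) = f (cover Φ z) := cover_localRep (hrU hz)
    have hgz₀ : cover Φ' (g z₀) = f (cover Φ z₀) := cover_localRep (hrU (Metric.mem_ball_self hr))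
    simp only [hF]
    rw [← hgz, ← hgz₀, ← cover_sub, ← cover_sub, hconst z hz]
  have hF0 : F z = F 0 := hFlc.apply_eq_of_preconnectedSpace z 0
  simp only [hF, cover_zero, map_zero, sub_zero] at hF0
  rwa [sub_eq_iff_eq_add'] at hF0

/-- **Affine lift, existential form**: a holomorphic map of complex tori lifts to an affine map of
the universal covers, `f (π z) = π' (L z + c)`, with `L` continuous `ℂ`-linear (`= df`) carrying
the lattice `Φ(ℤ^ι)` into the lattice `Φ'(ℤ^ι')`. Lange–Birkenhake (1992), §1.1.2, Prop. 1.1.6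
and the paragraph before it (`F(Λ) ⊆ Λ'`). [cite: LangeBirkenhake1992, Proposition 1.1.6] -/
theorem exists_affine_lift {f : ComplexTorus Φ → ComplexTorus Φ'}
    (hf : MDifferentiable 𝓘(ℂ, E) 𝓘(ℂ, E') f) :
    ∃ (L : E →L[ℂ] E') (c : E'), (∀ x, mfderiv 𝓘(ℂ, E) 𝓘(ℂ, E') f x = L) ∧
      (∀ z, f (cover Φ z) = cover Φ' (L z + c)) ∧
      ∀ n : ι → ℤ, ∃ m : ι' → ℤ, L (latticeVec Φ n) = latticeVec Φ' m := by
  obtain ⟨L, hL⟩ := exists_mfderiv_eq_const hf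
  obtain ⟨c, hc⟩ := cover_surjective Φ' (f 0)
  refine ⟨L, c, hL, fun z ↦ ?_, fun n ↦ ?_⟩
  · rw [cover_add, hc, apply_cover_eq_of_mfderiv_eq hf hL]
  · have h := apply_cover_eq_of_mfderiv_eq hf hL (latticeVec Φ n)
    rw [cover_latticeVec] at h
    have h0 : cover Φ' (L (latticeVec Φ n)) = 0 := by simpa using h.symm
    obtain ⟨m, hm⟩ := (cover_eq_zero_iff Φ' _).1 h0
    exact ⟨m, hm⟩

/-! ### Prop. 1.1.6: holomorphic maps are translates of `mapMatrix A` -/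

omit [Fintype ι'] in
/-- **A `ℂ`-linear map carrying the lattice into the lattice is the analytic representation of an
integer matrix**: if `L (Φ n) ∈ Φ'(ℤ^ι')` for all `n ∈ ℤ^ι`, then `Φ' ∘ A_ℝ = L ∘ Φ` for the
integer matrix `A` of `L` in the lattice bases (Lange–Birkenhake (1992), §1.1.2: the rational
representation `ρᵣ` is the restriction of the analytic representation `ρₐ` to the lattices).
[cite: LangeBirkenhake1992, §1.1.2] -/
theorem exists_matrix_of_lattice_le {L : E →L[ℂ] E'}
    (hL : ∀ n : ι → ℤ, ∃ m : ι' → ℤ, L (latticeVec Φ n) = latticeVec Φ' m) :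
    ∃ A : Matrix ι' ι ℤ, ∀ x : ι → ℝ, Φ' ((A.map (Int.cast : ℤ → ℝ)).mulVec x) = L (Φ x) := by
  classical
  choose m hm using hL
  refine ⟨Matrix.of fun i' i ↦ m (Pi.single i 1) i', fun x ↦ ?_⟩
  -- both sides are `ℝ`-linear in `x`; compare them on the standard basis
  set T₁ : (ι → ℝ) →ₗ[ℝ] E' :=
    (Φ' : (ι' → ℝ) →L[ℝ] E').toLinearMap ∘ₗ
      Matrix.mulVecLin ((Matrix.of fun i' i ↦ m (Pi.single i 1) i').map (Int.cast : ℤ → ℝ))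
    with hT₁
  set T₂ : (ι → ℝ) →ₗ[ℝ] E' := (L.restrictScalars ℝ).toLinearMap ∘ₗ (Φ : (ι → ℝ) →L[ℝ] E).toLinearMap
    with hT₂
  suffices hT : T₁ = T₂ by
    have := LinearMap.congr_fun hT x
    simpa [hT₁, hT₂] using this
  refine LinearMap.pi_ext' fun i ↦ LinearMap.ext_ring ?_
  have hlat : latticeVec Φ (Pi.single i 1) = Φ (Pi.single i (1 : ℝ)) := by
    rw [latticeVec]
    congr 1
    funext j
    by_cases hj : j = i
    · subst hj; simp
    · simp [hj]
  have hcol : ((Matrix.of fun i' i ↦ m (Pi.single i 1) i').map (Int.cast : ℤ → ℝ)).mulVec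
      (Pi.single i (1 : ℝ)) = fun i' ↦ (m (Pi.single i 1) i' : ℝ) := by
    funext i'
    rw [Matrix.mulVec_single_one]
    rfl
  simp only [hT₁, hT₂, LinearMap.coe_comp, Function.comp_apply, LinearMap.coe_single,
    ContinuousLinearMap.coe_coe, ContinuousLinearEquiv.coe_coe, Matrix.mulVecLin_apply,
    ContinuousLinearMap.coe_restrictScalars', hcol]
  change Φ' _ = L (Φ (Pi.single i (1 : ℝ)))
  rw [← hlat, hm (Pi.single i 1), latticeVec]

omit [Fintype ι'] in
/-- `π' ∘ L = mapMatrix A ∘ π` when `Φ' ∘ A_ℝ = L ∘ Φ`. [cite: LangeBirkenhake1992, §1.1.2] -/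
theorem cover_apply_eq_mapMatrix_cover {L : E →L[ℂ] E'} {A : Matrix ι' ι ℤ}
    (hA : ∀ x : ι → ℝ, Φ' ((A.map (Int.cast : ℤ → ℝ)).mulVec x) = L (Φ x)) (z : E) :
    cover Φ' (L z) = mapMatrix Φ Φ' A (cover Φ z) := by
  obtain ⟨x, rfl⟩ := Φ.surjective z
  rw [cover_apply_apply, mapMatrix_proj, ← hA, cover_apply_apply]

/-- **Lange–Birkenhake Prop. 1.1.6: every holomorphic map of complex tori is a translate of a
homomorphism.** For a holomorphic `f : X = E/Φ(ℤ^ι) → X' = E'/Φ'(ℤ^ι')` there are an integer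
matrix `A ∈ M(ι' × ι, ℤ)` (the rational representation of the homomorphism part) and a continuous
`ℂ`-linear `L : E → E'` (its analytic representation) with `Φ' ∘ A_ℝ = L ∘ Φ` — so `mapMatrix A`
is holomorphic by `contMDiff_mapMatrix` —, `df ≡ L`, and `f x = mapMatrix A x + f 0` for all `x`.
[cite: LangeBirkenhake1992, Proposition 1.1.6] -/
theorem exists_eq_mapMatrix_add {f : ComplexTorus Φ → ComplexTorus Φ'}
    (hf : MDifferentiable 𝓘(ℂ, E) 𝓘(ℂ, E') f) :
    ∃ (A : Matrix ι' ι ℤ) (L : E →L[ℂ] E'),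
      (∀ x : ι → ℝ, Φ' ((A.map (Int.cast : ℤ → ℝ)).mulVec x) = L (Φ x)) ∧
      (∀ x, mfderiv 𝓘(ℂ, E) 𝓘(ℂ, E') f x = L) ∧
      ∀ x, f x = mapMatrix Φ Φ' A x + f 0 := by
  obtain ⟨L, c, hL, -, hlat⟩ := exists_affine_lift hf
  obtain ⟨A, hA⟩ := exists_matrix_of_lattice_le hlat
  refine ⟨A, L, hA, hL, fun x ↦ ?_⟩
  obtain ⟨z, rfl⟩ := cover_surjective Φ x
  rw [apply_cover_eq_of_mfderiv_eq hf hL, cover_apply_eq_mapMatrix_cover hA]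

/-- **A holomorphic map of complex tori fixing `0` is a homomorphism** `mapMatrix A` with `ℂ`-linear
analytic representation. [cite: LangeBirkenhake1992, Proposition 1.1.6] -/
theorem exists_eq_mapMatrix_of_map_zero {f : ComplexTorus Φ → ComplexTorus Φ'}
    (hf : MDifferentiable 𝓘(ℂ, E) 𝓘(ℂ, E') f) (h0 : f 0 = 0) :
    ∃ (A : Matrix ι' ι ℤ) (L : E →L[ℂ] E'),
      (∀ x : ι → ℝ, Φ' ((A.map (Int.cast : ℤ → ℝ)).mulVec x) = L (Φ x)) ∧
      (∀ x, mfderiv 𝓘(ℂ, E) 𝓘(ℂ, E') f x = L) ∧ f = mapMatrix Φ Φ' A := by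
  obtain ⟨A, L, hA, hL, hf'⟩ := exists_eq_mapMatrix_add hf
  exact ⟨A, L, hA, hL, funext fun x ↦ by rw [hf' x, h0, add_zero]⟩

/-- **A holomorphic map of complex tori fixing `0` is additive.** [cite: LangeBirkenhake1992, Proposition 1.1.6] -/
theorem map_add_of_mdifferentiable {f : ComplexTorus Φ → ComplexTorus Φ'}
    (hf : MDifferentiable 𝓘(ℂ, E) 𝓘(ℂ, E') f) (h0 : f 0 = 0) (x y : ComplexTorus Φ) :
    f (x + y) = f x + f y := by
  obtain ⟨A, -, -, -, rfl⟩ := exists_eq_mapMatrix_of_map_zero hf h0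
  exact mapMatrix_add A x y

/-- **A holomorphic map of complex tori is a homomorphism followed by a translation**:
`f (x + y) + f 0 = f x + f y`. [cite: LangeBirkenhake1992, Proposition 1.1.6] -/
theorem map_add_add_map_zero {f : ComplexTorus Φ → ComplexTorus Φ'}
    (hf : MDifferentiable 𝓘(ℂ, E) 𝓘(ℂ, E') f) (x y : ComplexTorus Φ) :
    f (x + y) + f 0 = f x + f y := by
  obtain ⟨A, -, -, -, hf'⟩ := exists_eq_mapMatrix_add hf
  rw [hf' (x + y), hf' x, hf' y, mapMatrix_add]
  abel

/-! ### The rational and analytic representations are well defined (faithfulness) -/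

/-- **The analytic representation is the differential**: if `f = mapMatrix A + f 0` then
`realRep A = df` (as real-linear maps), whatever `A`. [cite: LangeBirkenhake1992, §1.1.2] -/
theorem realRep_eq_mfderiv {f : ComplexTorus Φ → ComplexTorus Φ'} {A : Matrix ι' ι ℤ}
    (hfA : ∀ x, f x = mapMatrix Φ Φ' A x + f 0) (x : ComplexTorus Φ) :
    realRep Φ Φ' A = mfderiv 𝓘(ℝ, E) 𝓘(ℝ, E') f x := by
  have hf : f = (fun y : ComplexTorus Φ' ↦ y + f 0) ∘ mapMatrix Φ Φ' A := funext hfA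
  have h := ((contMDiff_add_const (𝕜 := ℝ) (n := 1) (f 0)).mdifferentiable one_ne_zero
    (mapMatrix Φ Φ' A x)).hasMFDerivAt.comp x
    ((contMDiff_real_mapMatrix (n := 1) A).mdifferentiable one_ne_zero x).hasMFDerivAt
  have h2 := h.mfderiv
  rw [mfderiv_add_const, mfderiv_mapMatrix] at h2
  rw [hf, h2]
  ext v
  rfl

/-- **The rational representation is faithful**: `mapMatrix A = mapMatrix B` only if `A = B`
(two integer matrices inducing the same homomorphism of tori have the same analytic
representation, the differential, and `Φ`, `Φ'` are injective). Lange–Birkenhake (1992), §1.1.2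
(injectivity of `ρᵣ : Hom(X, X') → Hom_ℤ(Λ, Λ')`). [cite: LangeBirkenhake1992, §1.1.2] -/
theorem mapMatrix_injective : Function.Injective (mapMatrix Φ Φ' : Matrix ι' ι ℤ → _) := by
  classical
  intro A B hAB
  have hrep : realRep Φ Φ' A = realRep Φ Φ' B := by
    rw [← mfderiv_mapMatrix A (0 : ComplexTorus Φ), ← mfderiv_mapMatrix B (0 : ComplexTorus Φ), hAB]
  ext i' i
  have h := congrArg (fun T : E →L[ℝ] E' ↦ Φ'.symm (T (Φ (Pi.single i 1))) i') hrep
  simp only [realRep_apply, ContinuousLinearEquiv.symm_apply_apply, Matrix.mulVec_single_one,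
    Matrix.col_apply, Matrix.map_apply] at h
  exact_mod_cast h

/-- The matrix `A` of Prop. 1.1.6 is unique: if `f = mapMatrix A + f 0 = mapMatrix B + f 0` then
`A = B`. [cite: LangeBirkenhake1992, §1.1.2] -/
theorem matrix_unique {f : ComplexTorus Φ → ComplexTorus Φ'} {A B : Matrix ι' ι ℤ}
    (hA : ∀ x, f x = mapMatrix Φ Φ' A x + f 0) (hB : ∀ x, f x = mapMatrix Φ Φ' B x + f 0) :
    A = B :=
  mapMatrix_injective (funext fun x ↦ add_right_cancel ((hA x).symm.trans (hB x)))

end ComplexTorus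

end Literature.Geometry.Kaehler

end
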